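import Mathlib
import HarnessLib
import Literature.NumberTheory.Automorphic.ACCAutomorphyLiftingCrystalline
import Literature.NumberTheory.GaloisRepresentations.DecomposedGenericOfQuadratic
import Literature.NumberTheory.GaloisRepresentations.ResidualRepRestrict
import Literature.NumberTheory.GaloisRepresentations.ResidualGaloisRepOpenKernel
import Literature.NumberTheory.GaloisRepresentations.StableLatticeValuationRing
import Summits.Langlands.Langlands.Theorems.RamifiedCoefficientSeedAdjointLiftingGL3StubAdjointResidualImageHelpers

/-!
# Stub B (`stub_adjointResidualImage`) of crux `AdjointLiftingGL3`, line `birth`: the tree-provable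
# part of the residual image package, and the reduction of the stub to its IMAGE CORE

Crux `stmt-Langlands-16779` = `Summit.Langlands.Langlands.Theses.RamifiedCoefficientSeed.AdjointLiftingGL3`
(line `birth`, skeleton v2).  Stub B asks, for `p ≥ 11` and `ρ : Γ_ℚ → GL₃(ℚ̄_p)` crystalline with
labelled Hodge–Tate weights `{0,1,2}`, residually absolutely irreducible on `Γ_{ℚ(ζ_p)}` and of
adjoint shape `tr ρ ≡ η · (tr(ρ₀)²/det ρ₀ − 1) (mod 𝔪)`, for a residual representation
`τ : Γ_ℚ → GL₃(ℤ̄_p/𝔪)` of `ρ` which is (a) absolutely irreducible, (b) decomposed generic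
(ACC+ Def. 4.3.1), (c) absolutely irreducible on `Γ_{ℚ(ζ_p)}`, (d) of enormous image on
`Γ_{ℚ(ζ_p)}` (ACC+ Def. 6.2.28), (e) with `τ σ` scalar for some `σ ∉ Γ_{ℚ(ζ_p)}`.

## What is PROVED here (sorry-free, no named fact)

Running log of the tree lemmas found for the five steps of the paper proof (brief, (i)–(v)):

* (i) LATTICE BRIDGE — proved in full (`§1`): every residual representation `τ` of `ρ` (indeed
  every `τ` having the residual characteristic polynomials of `ρ`) is absolutely irreducible on
  `Γ_{ℚ(ζ_p)}` and on `Γ_ℚ` as soon as `ρ|_{Γ_{ℚ(ζ_p)}}` is residually absolutely irreducible, and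
  reductions / residual representations of `ρ` exist.  Tree inputs:
  `exists_integralModel_of_valuationSubring` (integral models over the non-Noetherian `ℤ̄_p`,
  `StableLatticeValuationRing`), `IsReductionOf.hasResidualCharpolys`, `HasResidualCharpolys.comp`
  / `.charpoly_eq` (`ResidualRepRestrict`, `ResidualRepUnique`),
  `Literature.RepresentationTheory.Semisimple.isIrreducible_of_charpoly_eq` (irreducibility is
  detected by characteristic polynomials: Brauer–Nesbitt over any field, `brauerNesbitt_holds`, +
  semisimplification), `range_absGaloisRestrict_eq_absGaloisGroupAdjoinRootsOfUnity` and
  `isIrreducible_glRepresentation_of_range_le` (`DecomposedGenericOfQuadratic`).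
* (iv) DECOMPOSED GENERIC — proved in full (helpers file
  `RamifiedCoefficientSeedAdjointLiftingGL3StubAdjointResidualImageHelpers`, and `§2`) from the
  existence of ONE `g ∈ Γ_{ℚ(ζ_p)}` with `τ g` regular semisimple, for any `τ : Γ_ℚ → GL_n(k)`
  with open kernel, `char k = p`: Chebotarev
  in the tree's proved coset form `infinite_setOf_prime_absNorm_frobenius_mul_inv_mem`
  (`ChebotarevCosetCyclotomic`, from `chebotarev_artinRep_holds`) for `N = ker τ ∩ Γ_{ℚ(ζ_p)}`,
  `residueCard_modEq_one_of_isArithFrobAt_of_mem` (`l ≡ 1 mod p`), transitivity of `Γ_ℚ` on the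
  primes above `l` (`exists_smul_eq_of_mem_primesAbove_holds`), `eigenvalueMultiset_conj`,
  Mathlib `NumberField.not_dvd_discr_iff_isUnramifiedIn` + `discr_rat` (every `l` splits
  completely in `ℚ`).  And (helpers) an ENORMOUS subgroup of `GL_n(k)`, `n ≥ 2`, contains a regular
  semisimple element (clause (3) of Def. 6.2.28 applied to a simple submodule of `ad⁰ ≠ 0`, which
  exists by Artinianity) — so (b) follows from (d).
* (a), (c) follow from (i); the residual representation is the reduction of any integral model
  (irreducible reductions are residual representations, `IsReductionOf.isResidualRepOf_of_isIrreducible`).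

## What is NOT proved: the IMAGE CORE (d) + (e)

On paper (refuters' REVIEW §3 / VETTING §5 on the item): (ii) Brauer–Nesbitt identification
`τ ≅ η̄ ⊗ ad⁰(ρ̄₀)` (tree: `brauerNesbitt_holds`, `GeneralLinearGroup.symSq`; needs characteristic
polynomials from traces, `p > 3`); (iii) Fontaine–Laffaille's description of `ρ̄^{ss}|_{I_p}` for
crystalline `HT = {0,1,2}` (NOT in the tree, where Fontaine–Laffaille enters only through BLGGT
Lemma 1.4.3 (2), `blggt2014_lemma_1_4_3_2`), then Dickson for the projective image of `ρ̄₀` (tree: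
the prime-to-`p` half is PROVED over any field, `Serre1972`-style `SerreProp16PGL2.prop16`; the
`p`-divisible half only inside `GL₂(𝔽_p)`, Prop. 15, `SerreSubgroupsGL2Fp`), then ACC+ Lemma 7.1.2
(arXiv:1812.09999 p. 98: `l > 2n+1`, `H ⊇ SL₂(𝔽_l)` finite ⇒ `Symm^{n-1} H` enormous) and
Lemma 7.1.3 (1)–(2) (`ζ_l ∉ F̄^{ker ad Symm^m r̄}`: the scalar element; enormousness on
`G_{F(ζ_l)}`), plus the remark after Def. 6.2.28 (enormousness only depends on the image in
`PGL_n`) — none of the last three is in the tree, and no theorem of the tree concludes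
`Subgroup.IsEnormous` of anything; (v) the scalar element (abelianisation of `PSL₂/PGL₂` of order
`≤ 2 < p − 1`).  So (d)+(e) are isolated as ONE residual statement (the "image core", hypothesis of
`adjointResidualImage_of_imageCore` below, in the exact shape of a re-registrable stub, `stub_adjointResidualImage_of_imageCore`'s hypothesis):

  for `p ≥ 11`, `ρ` as in the crux (crystalline `HT {0,1,2}`, `ρ̄|ℚ(ζ_p)` abs. irreducible,
  adjoint shape), EVERY residual representation `τ` of `ρ` which is absolutely irreducible on
  `Γ_{ℚ(ζ_p)}` (all are, §1) has `τ(Γ_{ℚ(ζ_p)})` enormous and a scalar `τ σ`, `σ ∉ Γ_{ℚ(ζ_p)}`,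

and `stub_adjointResidualImage_of_imageCore : imageCore → stub_adjointResidualImage` (the
registered signature of stub B verbatim) is proved, from the pointwise glue
`adjointResidualImage_of_imageCore` (the sub-goal registered for this file: at one `(p, ρ)`,
residual absolute irreducibility on `Γ_{ℚ(ζ_p)}` + image core ⇒ the full package).

## References

* [ACCGHLNSTT2023] P. B. Allen, F. Calegari, A. Caraiani, T. Gee, D. Helm, B. V. Le Hung, J. Newton,
  P. Scholze, R. Taylor, J. A. Thorne, *Potential automorphy over CM fields*, Ann. of Math. (2) 197
  (2023), 897–1113 (arXiv:1812.09999): Def. 4.3.1, Lemma 4.3.2, Def. 6.2.28, §7.1 Lemmas 7.1.2–7.1.3.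
* [DarmonDiamondTaylor1995] H. Darmon, F. Diamond, R. Taylor, *Fermat's Last Theorem* (1995), §2.1
  (reductions, Brauer–Nesbitt).
* [TateGCFT1967] J. Tate, *Global class field theory*, in Cassels–Fröhlich (1967), Ch. VII §2.4
  (Chebotarev, existence form).
-/

set_option linter.dupNamespace false

noncomputable section

namespace Summit.Langlands.Langlands.Cruxes.AdjointLiftingGL3.Birth

open scoped MatrixGroups NumberField Polynomial
open NumberField IsDedekindDomain Field Filter
open Literature.NumberTheory.GaloisRepresentations Literature.NumberTheory.PAdicHodge
open Literature.NumberTheory.Automorphic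
universe u v w

/-! ## §1. The lattice bridge: residual representations of `ρ` and of `ρ|_{Γ_{ℚ(ζ_p)}}` -/

section Bridge

variable {K : Type} [Field K] {p : ℕ} [Fact p.Prime] {n : ℕ}

/-- **Reductions of `ρ : Γ_K → GL_n(ℚ̄_p)` exist**: `Γ_K` is compact, so `ρ` has an integral model
over the (open, non-Noetherian) valuation ring `ℤ̄_p` (`exists_integralModel_of_valuationSubring`),
whose reduction mod `𝔪` is a reduction of `ρ`. [cite: DarmonDiamondTaylor1995, §2.1, p. 54] -/
theorem exists_isReductionOf [CharZero K] (ρ : FramedGaloisRep K (PadicAlgCl p) n) :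
    ∃ τ : absoluteGaloisGroup K →* GL (Fin n) (padicAlgClResidueField p),
      ρ.IsReductionOf (RingHom.id _) τ := by
  obtain ⟨P, ρ₀, hP⟩ := exists_integralModel_of_valuationSubring (O := padicAlgClIntegers p)
    (Valued.isOpen_valuationSubring (PadicAlgCl p)) ρ
  refine ⟨integralReduction (RingHom.id _) ρ₀, ρ₀, 1, ⟨P, fun g => hP g⟩, fun g => ?_⟩
  rw [inv_one, one_mul, mul_one]

/-- **The bridge, characteristic-polynomial form.**  Let `ρ : Γ_ℚ → GL_n(ℚ̄_p)` be such that
`ρ|_{Γ_L}`, `L = ℚ(ζ_p)` (`CyclotomicField p ℚ`), is residually absolutely irreducible, and let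
`τ : Γ_ℚ → GL_n(ℤ̄_p/𝔪)` have the residual characteristic polynomials of `ρ` (e.g. any reduction or
residual representation of `ρ`).  Then `τ` is absolutely irreducible on the subgroup
`Γ_{ℚ(ζ_p)} = res(Γ_L)` and on `Γ_ℚ`: `τ ∘ res` and the absolutely irreducible reduction of
`ρ|_{Γ_L}` both have the residual characteristic polynomials of `ρ|_{Γ_L}`, hence the same
characteristic polynomials, so `τ ∘ res` is absolutely irreducible (`isAbsIrreducible_of_charpoly_eq`),
and `(τ ∘ res)(Γ_L) = τ(Γ_{ℚ(ζ_p)}) ⊆ τ(Γ_ℚ)`. [cite: DarmonDiamondTaylor1995, §2.1] -/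
theorem isAbsIrreducible_of_hasResidualCharpolys_of_restrictField
    (ρ : FramedGaloisRep ℚ (PadicAlgCl p) n)
    (hirr : (ρ.restrictField (CyclotomicField p ℚ)).IsResiduallyAbsIrreducible)
    {τ : absoluteGaloisGroup ℚ →* GL (Fin n) (padicAlgClResidueField p)}
    (hτ : HasResidualCharpolys (RingHom.id _)
      (ρ : absoluteGaloisGroup ℚ →* GL (Fin n) (PadicAlgCl p)) τ) :
    IsAbsIrreducible (τ.comp (absGaloisGroupAdjoinRootsOfUnity ℚ p).subtype) ∧
      IsAbsIrreducible τ := by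
  have hp : p.Prime := Fact.out
  haveI : NeZero ((p : ℕ) : ℚ) := ⟨Nat.cast_ne_zero.mpr hp.ne_zero⟩
  haveI : IsCyclotomicExtension {p} ℚ (CyclotomicField p ℚ) :=
    CyclotomicField.isCyclotomicExtension p ℚ
  set res := (absGaloisRestrict ℚ (CyclotomicField p ℚ)).toMonoidHom with hres
  obtain ⟨τL, hτL, habsL⟩ := hirr
  -- `τ ∘ res` has the residual characteristic polynomials of `ρ|_{Γ_L} = ρ ∘ res`
  have h1 : HasResidualCharpolys (RingHom.id _)
      ((ρ.restrictField (CyclotomicField p ℚ) : FramedGaloisRep (CyclotomicField p ℚ) (PadicAlgCl p) n) :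
        absoluteGaloisGroup (CyclotomicField p ℚ) →* GL (Fin n) (PadicAlgCl p)) (τ.comp res) :=
    hτ.comp res
  have hcp : ∀ h, ((τ.comp res h : GL (Fin n) (padicAlgClResidueField p)) :
      Matrix (Fin n) (Fin n) (padicAlgClResidueField p)).charpoly =
      ((τL h : GL (Fin n) (padicAlgClResidueField p)) :
        Matrix (Fin n) (Fin n) (padicAlgClResidueField p)).charpoly :=
    fun h => h1.charpoly_eq hτL.hasResidualCharpolys h
  have habs : IsAbsIrreducible (τ.comp res) := isAbsIrreducible_of_charpoly_eq hcp habsL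
  have hrange : (τ.comp res).range = (τ.comp (absGaloisGroupAdjoinRootsOfUnity ℚ p).subtype).range := by
    rw [MonoidHom.range_comp, MonoidHom.range_comp, Subgroup.range_subtype]
    congr 1
    exact range_absGaloisRestrict_eq_absGaloisGroupAdjoinRootsOfUnity ℚ (CyclotomicField p ℚ) p
  refine ⟨IsAbsIrreducible.of_range_le habs hrange.le, IsAbsIrreducible.of_range_le habs ?_⟩
  rw [MonoidHom.range_comp]
  exact Subgroup.map_le_range _ _

/-- **Every residual representation of `ρ` is absolutely irreducible on `Γ_{ℚ(ζ_p)}` and on `Γ_ℚ`**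
when `ρ|_{Γ_{ℚ(ζ_p)}}` is residually absolutely irreducible (a residual representation has the
residual characteristic polynomials of `ρ`). [cite: DarmonDiamondTaylor1995, §2.1] -/
theorem isAbsIrreducible_of_isResidualRepOf_of_restrictField
    (ρ : FramedGaloisRep ℚ (PadicAlgCl p) n)
    (hirr : (ρ.restrictField (CyclotomicField p ℚ)).IsResiduallyAbsIrreducible)
    {τ : absoluteGaloisGroup ℚ →* GL (Fin n) (padicAlgClResidueField p)}
    (hτ : ρ.IsResidualRepOf (RingHom.id _) τ) :
    IsAbsIrreducible (τ.comp (absGaloisGroupAdjoinRootsOfUnity ℚ p).subtype) ∧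
      IsAbsIrreducible τ :=
  isAbsIrreducible_of_hasResidualCharpolys_of_restrictField ρ hirr hτ.hasResidualCharpolys

/-- **Existence of an absolutely irreducible residual representation.**  If `ρ|_{Γ_{ℚ(ζ_p)}}` is
residually absolutely irreducible then `ρ : Γ_ℚ → GL_n(ℚ̄_p)` has a residual representation
`τ : Γ_ℚ → GL_n(ℤ̄_p/𝔪)` — the reduction of any integral model, which is (absolutely) irreducible,
hence its own semisimplification — absolutely irreducible on `Γ_{ℚ(ζ_p)}` and on `Γ_ℚ`.
[cite: DarmonDiamondTaylor1995, §2.1] -/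
theorem exists_isResidualRepOf_isAbsIrreducible (ρ : FramedGaloisRep ℚ (PadicAlgCl p) n)
    (hirr : (ρ.restrictField (CyclotomicField p ℚ)).IsResiduallyAbsIrreducible) :
    ∃ τ : absoluteGaloisGroup ℚ →* GL (Fin n) (padicAlgClResidueField p),
      ρ.IsResidualRepOf (RingHom.id _) τ ∧ ρ.IsReductionOf (RingHom.id _) τ ∧
        IsAbsIrreducible (τ.comp (absGaloisGroupAdjoinRootsOfUnity ℚ p).subtype) ∧
        IsAbsIrreducible τ := by
  obtain ⟨τ, hτ⟩ := exists_isReductionOf ρ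
  obtain ⟨h1, h2⟩ :=
    isAbsIrreducible_of_hasResidualCharpolys_of_restrictField ρ hirr hτ.hasResidualCharpolys
  exact ⟨τ, hτ.isResidualRepOf_of_isIrreducible h2.isIrreducible_glRepresentation, hτ, h1, h2⟩

end Bridge

/-! ## §2. Decomposed generic for residual representations over `ℤ̄_p/𝔪` -/

section DecomposedGeneric

variable {p : ℕ} [Fact p.Prime] {n : ℕ}

/-- **Decomposed generic from enormous image on `Γ_{ℚ(ζ_p)}`** (`n ≥ 2`): an enormous
`τ(Γ_{ℚ(ζ_p)})` contains a regular semisimple `τ g`, `g ∈ Γ_{ℚ(ζ_p)}`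
(`exists_isRegularSemisimple_of_isEnormous`), and Chebotarev does the rest.  So hypothesis
"decomposed generic" of ACC+ Thm. 6.1.1 over `ℚ` is implied by its hypothesis "enormous".
[cite: ACCGHLNSTT2023, Def. 4.3.1, Def. 6.2.28] -/
theorem isDecomposedGeneric_of_isResidualRepOf_of_isEnormous (hn : 2 ≤ n)
    (ρ : FramedGaloisRep ℚ (PadicAlgCl p) n)
    {τ : absoluteGaloisGroup ℚ →* GL (Fin n) (padicAlgClResidueField p)}
    (hτ : ρ.IsResidualRepOf (RingHom.id _) τ)
    (hen : Subgroup.IsEnormous ((absGaloisGroupAdjoinRootsOfUnity ℚ p).map τ)) :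
    IsDecomposedGeneric τ := by
  obtain ⟨h, ⟨g, hg, rfl⟩, hreg⟩ := exists_isRegularSemisimple_of_isEnormous hen hn
  exact adjointResidualImage_decomposedGeneric p n ρ τ hτ ⟨g, hg, hreg⟩

end DecomposedGeneric

/-! ## §3. Stub B from its image core -/

section Assembly

/-- **Stub B at one `(p, ρ)` from the image core** (the sub-goal registered on the crux item for
this file).  Let `ρ : Γ_ℚ → GL₃(ℚ̄_p)` have `ρ|_{Γ_{ℚ(ζ_p)}}` residually absolutely irreducible, and
suppose (IMAGE CORE) that every residual representation `τ` of `ρ` which is absolutely irreducible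
on `Γ_{ℚ(ζ_p)}` has enormous image on `Γ_{ℚ(ζ_p)}` and a scalar `τ σ` for some `σ ∉ Γ_{ℚ(ζ_p)}`.
Then `ρ` has a residual representation with the full residual image package of ACC+ Thm. 6.1.1
(3)–(4): absolutely irreducible, decomposed generic, absolutely irreducible and enormous on
`Γ_{ℚ(ζ_p)}`, with a scalar element off `Γ_{ℚ(ζ_p)}` — by §1 (existence and absolute
irreducibility) and §2 (decomposed generic from enormous).  No crystalline / adjoint-shape
hypothesis is needed for this glue; they only feed the image core.
[cite: ACCGHLNSTT2023, Thm. 6.1.1 (3)–(4), Def. 4.3.1, Def. 6.2.28] -/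
theorem adjointResidualImage_of_imageCore :
    ∀ (p : ℕ) [Fact p.Prime] (ρ : FramedGaloisRep ℚ (PadicAlgCl p) 3),
      (ρ.restrictField (CyclotomicField p ℚ)).IsResiduallyAbsIrreducible →
      (∀ τ : absoluteGaloisGroup ℚ →* GL (Fin 3) (padicAlgClResidueField p),
        ρ.IsResidualRepOf (RingHom.id _) τ →
          IsAbsIrreducible (τ.comp (absGaloisGroupAdjoinRootsOfUnity ℚ p).subtype) →
          Subgroup.IsEnormous ((absGaloisGroupAdjoinRootsOfUnity ℚ p).map τ) ∧
            ∃ σ : absoluteGaloisGroup ℚ, σ ∉ absGaloisGroupAdjoinRootsOfUnity ℚ p ∧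
              ∃ c : padicAlgClResidueField p,
                ((τ σ : GL (Fin 3) (padicAlgClResidueField p)) :
                  Matrix (Fin 3) (Fin 3) (padicAlgClResidueField p)) = c • (1 : Matrix _ _ _)) →
      ∃ τ : absoluteGaloisGroup ℚ →* GL (Fin 3) (padicAlgClResidueField p),
        ρ.IsResidualRepOf (RingHom.id _) τ ∧ IsAbsIrreducible τ ∧ IsDecomposedGeneric τ ∧
          IsAbsIrreducible (τ.comp (absGaloisGroupAdjoinRootsOfUnity ℚ p).subtype) ∧
          Subgroup.IsEnormous ((absGaloisGroupAdjoinRootsOfUnity ℚ p).map τ) ∧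
          ∃ σ : absoluteGaloisGroup ℚ, σ ∉ absGaloisGroupAdjoinRootsOfUnity ℚ p ∧
            ∃ c : padicAlgClResidueField p,
              ((τ σ : GL (Fin 3) (padicAlgClResidueField p)) :
                Matrix (Fin 3) (Fin 3) (padicAlgClResidueField p)) = c • (1 : Matrix _ _ _) := by
  intro p _ ρ hirr hcore
  obtain ⟨τ, hτ, -, habs₁, habs⟩ := exists_isResidualRepOf_isAbsIrreducible ρ hirr
  obtain ⟨hen, hscalar⟩ := hcore τ hτ habs₁
  exact ⟨τ, hτ, habs, isDecomposedGeneric_of_isResidualRepOf_of_isEnormous (by norm_num) ρ hτ hen,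
    habs₁, hen, hscalar⟩

/-- **Stub B (`stub_adjointResidualImage`, registered signature verbatim) from its IMAGE CORE.**
The hypothesis `hcore` is the residual statement isolated in the module docstring — for `p ≥ 11`
and `ρ : Γ_ℚ → GL₃(ℚ̄_p)` crystalline at `p` with labelled Hodge–Tate weights `{0,1,2}`,
`ρ̄|_{Γ_{ℚ(ζ_p)}}` absolutely irreducible and `tr ρ ≡ η (tr(ρ₀)²/det ρ₀ − 1) (mod 𝔪)`, EVERY residual
representation `τ` of `ρ` which is absolutely irreducible on `Γ_{ℚ(ζ_p)}` (they all are, §2) has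
`τ(Γ_{ℚ(ζ_p)})` enormous (ACC+ Def. 6.2.28) and `τ σ` scalar for some `σ ∉ Γ_{ℚ(ζ_p)}` (on paper: Brauer–Nesbitt `τ ≅ η̄ ⊗ ad⁰ ρ̄₀`, Fontaine–Laffaille inertial
weights, Dickson, ACC+ Lemmas 7.1.2–7.1.3) —; the conclusion is the registered stub: the crystalline
and adjoint-shape hypotheses are only passed on to `hcore`, everything else (existence of `τ`,
absolute irreducibility on `Γ_ℚ` and `Γ_{ℚ(ζ_p)}`, decomposed genericity) is proved in this file.
[cite: ACCGHLNSTT2023, Thm. 6.1.1 (3)–(4), Def. 4.3.1, Def. 6.2.28] -/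
theorem stub_adjointResidualImage_of_imageCore :
    (∀ (p : ℕ) [Fact p.Prime], 11 ≤ p →
      ∀ ρ : FramedGaloisRep ℚ (PadicAlgCl p) 3,
        (∀ (v : HeightOneSpectrum (𝓞 ℚ)) (hv : ((p : ℕ) : 𝓞 ℚ) ∈ v.asIdeal),
          let D := fontainePstAdicCompletion v p hv;
          D.IsCrystallineFramed (ρ.toLocal v) ∧
            (letI := D.algebra;
             ∀ τ' : v.adicCompletion ℚ →ₐ[ℚ_[p]] PadicAlgCl p,
               ρ.labelledHodgeTateWeightsAt v D.algebra D.𝔅 τ'.toRingHom = {0, 1, 2})) →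
        (ρ.restrictField (CyclotomicField p ℚ)).IsResiduallyAbsIrreducible →
        (∃ (ρ₀ : FramedGaloisRep ℚ (PadicAlgCl p) 2) (η : FramedGaloisRep ℚ (PadicAlgCl p) 1),
          ∀ σ, ‖(ρ σ).val.trace - (η σ).val 0 0 *
            ((ρ₀ σ).val.trace ^ 2 * ((ρ₀ σ).val.det)⁻¹ - 1)‖ < 1) →
        ∀ τ : absoluteGaloisGroup ℚ →* GL (Fin 3) (padicAlgClResidueField p),
          ρ.IsResidualRepOf (RingHom.id _) τ →
            IsAbsIrreducible (τ.comp (absGaloisGroupAdjoinRootsOfUnity ℚ p).subtype) →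
            Subgroup.IsEnormous ((absGaloisGroupAdjoinRootsOfUnity ℚ p).map τ) ∧
              ∃ σ : absoluteGaloisGroup ℚ, σ ∉ absGaloisGroupAdjoinRootsOfUnity ℚ p ∧
                ∃ c : padicAlgClResidueField p,
                  ((τ σ : GL (Fin 3) (padicAlgClResidueField p)) :
                    Matrix (Fin 3) (Fin 3) (padicAlgClResidueField p)) = c • (1 : Matrix _ _ _)) →
    ∀ (p : ℕ) [Fact p.Prime], 11 ≤ p →
      ∀ ρ : FramedGaloisRep ℚ (PadicAlgCl p) 3,
        (∀ (v : HeightOneSpectrum (𝓞 ℚ)) (hv : ((p : ℕ) : 𝓞 ℚ) ∈ v.asIdeal),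
          let D := fontainePstAdicCompletion v p hv;
          D.IsCrystallineFramed (ρ.toLocal v) ∧
            (letI := D.algebra;
             ∀ τ' : v.adicCompletion ℚ →ₐ[ℚ_[p]] PadicAlgCl p,
               ρ.labelledHodgeTateWeightsAt v D.algebra D.𝔅 τ'.toRingHom = {0, 1, 2})) →
        (ρ.restrictField (CyclotomicField p ℚ)).IsResiduallyAbsIrreducible →
        (∃ (ρ₀ : FramedGaloisRep ℚ (PadicAlgCl p) 2) (η : FramedGaloisRep ℚ (PadicAlgCl p) 1),
          ∀ σ, ‖(ρ σ).val.trace - (η σ).val 0 0 *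
            ((ρ₀ σ).val.trace ^ 2 * ((ρ₀ σ).val.det)⁻¹ - 1)‖ < 1) →
        ∃ τ : absoluteGaloisGroup ℚ →* GL (Fin 3) (padicAlgClResidueField p),
          ρ.IsResidualRepOf (RingHom.id _) τ ∧ IsAbsIrreducible τ ∧ IsDecomposedGeneric τ ∧
            IsAbsIrreducible (τ.comp (absGaloisGroupAdjoinRootsOfUnity ℚ p).subtype) ∧
            Subgroup.IsEnormous ((absGaloisGroupAdjoinRootsOfUnity ℚ p).map τ) ∧
            ∃ σ : absoluteGaloisGroup ℚ, σ ∉ absGaloisGroupAdjoinRootsOfUnity ℚ p ∧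
              ∃ c : padicAlgClResidueField p,
                ((τ σ : GL (Fin 3) (padicAlgClResidueField p)) :
                  Matrix (Fin 3) (Fin 3) (padicAlgClResidueField p)) = c • (1 : Matrix _ _ _) := by
  intro hcore p _ hp ρ hcrys hirr hseed
  exact adjointResidualImage_of_imageCore p ρ hirr (hcore p hp ρ hcrys hirr hseed)

end Assembly

end Summit.Langlands.Langlands.Cruxes.AdjointLiftingGL3.Birth

end
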